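import Mathlib
import Summits.Ventures.PercRepro2.Defs
import Summits.Ventures.PercRepro2.Graph
import Summits.Ventures.PercRepro2.OneColourSwitch
import Summits.Ventures.PercRepro2.RegionHubSign
import Summits.Ventures.PercRepro2.SideSwitch
import Summits.Ventures.PercRepro2.TermSwitchDefs
import Summits.Ventures.PercRepro2.TermSwitchReach
import Summits.Ventures.PercRepro2.M9NoPocketDefs
import Summits.Ventures.PercRepro2.M9Unreached
import Summits.Ventures.PercRepro2.M9GeneralDSplit
import Summits.Ventures.PercRepro2.M9GeneralDHD

/-!
# CLASS C7 of the single-`d` statement — every linking block is joined to `d`: the reduction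
(blind cell PercRepro2, p3 g29, 2026-08-28; `proofs/P3-LINKED.md` §1–§2)

The **linked hypothesis** `Linked ends r s d`: in every colouring `ω` in which `r ~ s` but
`r ≁ d`, some neighbour `x ∉ {r, s, d}` of `d` is connected to `r` — i.e. every `r–s` path of
`G − d` has an internal vertex adjacent to `d` (`N(d) ∖ {r, s}` separates `r` from `s` in `G − d`;
the class contains the graphs `r–v₁–…–v_k–s` with `d` adjacent to every `v_i` and an arbitrary
pocket on `d, p, q`).  Under it an `HD` colouring with `d ∈ K₂` has **no `W`-connection `r ~ s`**
(`not_conn_compl_rs_of_HD_K`): a `W`-path `r → s` avoids `d` (`d ∉ M₂`), so it meets a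
neighbour `x` of `d` with `x ∈ M₂`, and the edge `d–x` is `W` (then `d ∈ M₂`) or `Y` (then
`x ∈ K₂ ∩ M₂`, against `DZero`).  Hence on `HD ∧ d ∈ K₂` the sign `σ_rs` is the indicator of
`r ~_Y s`, and with the colour flip (`HD_compl`) the hub–dead-end sum is
`hdSum = 2 · hdKSum = 2 · hdKYSum` (`hdSum_eq_two_mul_hdKSum`, `hdKSum_eq_hdKYSum`), where
`hdKYSum = Σ_{HD ∧ d ∈ K₂ ∧ r ~_Y s} σ_pq`.  With `dSignSum ≤ hdSum` (`M9GeneralDSplit`) the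
general single-`d` statement in class C7 reduces to the one lemma `hdKYSum ≤ 0`
(`dSignSum_nonpos_of_hdKYSum_nonpos`) — the `Y_rs`-part of the dirty one-sided points, an up-set
of every `Y`-pocket group (`P3-POCKET.md` §4(i), `P3-LINKED.md` §2 (L2)).  Own work; std axioms.
-/

namespace Summit.Ventures.PercRepro2

namespace NoPocket

open Finset Classical RegionHub OneColourSwitch SideSwitch TermSwitch

variable {V : Type*} {E : Type*}

section Linked

variable {ends : E → Sym2 V} {p q r s d : V}

/-- **The linked hypothesis (class C7)**: whenever `r ~ s` in a colouring in which `r ≁ d`, some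
neighbour `x ∉ {r, s, d}` of `d` is connected to `r` — every `r–s` path avoiding `d` passes
through a neighbour of `d`. -/
def Linked (ends : E → Sym2 V) (r s d : V) : Prop :=
  ∀ ω : Config E, Conn ends ω r s → ¬ Conn ends ω r d →
    ∃ x e, ends e = s(d, x) ∧ x ≠ r ∧ x ≠ s ∧ x ≠ d ∧ Conn ends ω r x

/-- The colour preference of a pair is negated by the colour flip. -/
lemma sigma_compl_eq_neg (ω : Config E) (a b : V) :
    sigma ends (OneColourSwitch.compl ω) a b = - sigma ends ω a b := by
  simp only [sigma, OneColourSwitch.compl_compl]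
  ring

/-- **No `W`-connection `r ~ s` on the `K`-side hub–dead-end colourings** under the linked
hypothesis. -/
lemma not_conn_compl_rs_of_HD_K (hL : Linked ends r s d) {ω : Config E}
    (h : HD ends p q r s d ω) (hK : d ∈ K2 ends r s ω) :
    ¬ Conn ends (OneColourSwitch.compl ω) r s := by
  intro hrs
  obtain ⟨_, hDZ, hone, -⟩ := hd_iff_dzero.1 h
  have hM : d ∉ M2 ends r s ω := by
    rcases hone with ⟨_, hM⟩ | ⟨_, hK'⟩
    · exact hM
    · exact absurd hK hK'
  have hrd' : ¬ Conn ends (OneColourSwitch.compl ω) r d :=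
    fun hc => hM (mem_M2_iff.2 (Or.inl hc))
  obtain ⟨x, e, he, hxr, hxs, _, hrx⟩ := hL (OneColourSwitch.compl ω) hrs hrd'
  have hxM : x ∈ M2 ends r s ω := mem_M2_iff.2 (Or.inl hrx)
  by_cases hωe : ω e = true
  · -- the edge `d–x` is `Y`: `x` is doubly reached
    have hdx : Conn ends ω d x := conn_of_openAdj ⟨e, hωe, he⟩
    have hxK : x ∈ K2 ends r s ω := by
      rcases mem_K2_iff.1 hK with h1 | h1
      · exact mem_K2_iff.2 (Or.inl (conn_trans h1 hdx))
      · exact mem_K2_iff.2 (Or.inr (conn_trans h1 hdx))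
    exact hDZ x hxr hxs hxK hxM
  · -- the edge `d–x` is `W`: `d` lies in the `W`-world
    have hωe' : OneColourSwitch.compl ω e = true := by
      simp only [OneColourSwitch.compl]
      rw [Bool.not_eq_true] at hωe
      rw [hωe]
      rfl
    have hdx : Conn ends (OneColourSwitch.compl ω) d x := conn_of_openAdj ⟨e, hωe', he⟩
    exact hM (mem_M2_iff.2 (Or.inl (conn_trans hrx (conn_symm hdx))))

end Linked

section Sum

variable [Fintype E] [DecidableEq E] {ends : E → Sym2 V} {p q r s d : V}

/-- The `K`-side hub–dead-end sum: `Σ_{HD ∧ d ∈ K₂} σ_pq · σ_rs`. -/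
noncomputable def hdKSum (ends : E → Sym2 V) (p q r s d : V) : ℤ :=
  ∑ ω : Config E, if HD ends p q r s d ω ∧ d ∈ K2 ends r s ω then
    sigma ends ω p q * sigma ends ω r s else 0

/-- The `Y_rs`-part of the `K`-side hub–dead-end sum: `Σ_{HD ∧ d ∈ K₂ ∧ r ~_Y s} σ_pq`. -/
noncomputable def hdKYSum (ends : E → Sym2 V) (p q r s d : V) : ℤ :=
  ∑ ω : Config E, if HD ends p q r s d ω ∧ d ∈ K2 ends r s ω ∧ Conn ends ω r s then
    sigma ends ω p q else 0

/-- **The hub–dead-end sum is twice its `K`-side** (the colour flip exchanges the two sides). -/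
theorem hdSum_eq_two_mul_hdKSum :
    hdSum ends p q r s d = 2 * hdKSum ends p q r s d := by
  have hsplit : ∀ ω : Config E,
      (if HD ends p q r s d ω then sigma ends ω p q * sigma ends ω r s else 0) =
        (if HD ends p q r s d ω ∧ d ∈ K2 ends r s ω then
          sigma ends ω p q * sigma ends ω r s else 0) +
        (if HD ends p q r s d ω ∧ d ∈ M2 ends r s ω then
          sigma ends ω p q * sigma ends ω r s else 0) := by
    intro ω
    by_cases h : HD ends p q r s d ω
    · obtain ⟨_, _, hone, _⟩ := hd_iff_dzero.1 h
      rcases hone with ⟨hK, hM⟩ | ⟨hM, hK⟩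
      · simp [h, hK, hM]
      · simp [h, hK, hM]
    · simp [h]
  have hMK : (∑ ω : Config E, if HD ends p q r s d ω ∧ d ∈ M2 ends r s ω then
      sigma ends ω p q * sigma ends ω r s else 0) = hdKSum ends p q r s d := by
    unfold hdKSum
    refine Fintype.sum_equiv complPerm _ _ (fun ω => ?_)
    simp only [complPerm, Function.Involutive.coe_toPerm]
    rw [HD_compl, K2_compl, sigma_compl_eq_neg, sigma_compl_eq_neg, neg_mul_neg]
  unfold hdSum
  rw [Finset.sum_congr rfl (fun ω _ => hsplit ω), Finset.sum_add_distrib, hMK]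
  unfold hdKSum
  ring

/-- Under the linked hypothesis the `K`-side sum is its `Y_rs`-part: `σ_rs = 1[r ~_Y s]` there. -/
theorem hdKSum_eq_hdKYSum (hL : Linked ends r s d) :
    hdKSum ends p q r s d = hdKYSum ends p q r s d := by
  unfold hdKSum hdKYSum
  refine Finset.sum_congr rfl fun ω _ => ?_
  by_cases h : HD ends p q r s d ω ∧ d ∈ K2 ends r s ω
  · have hW := not_conn_compl_rs_of_HD_K (p := p) (q := q) hL h.1 h.2
    by_cases hY : Conn ends ω r s
    · rw [if_pos h, if_pos ⟨h.1, h.2, hY⟩]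
      simp only [sigma]
      rw [if_pos hY, if_neg hW]
      ring
    · rw [if_pos h, if_neg (fun h' => hY h'.2.2)]
      simp only [sigma]
      rw [if_neg hY, if_neg hW]
      ring
  · rw [if_neg h, if_neg (fun h' => h ⟨h'.1, h'.2.1⟩)]

/-- **`hdSum = 2 · hdKYSum`** under the linked hypothesis. -/
theorem hdSum_eq_two_mul_hdKYSum (hL : Linked ends r s d) :
    hdSum ends p q r s d = 2 * hdKYSum ends p q r s d := by
  rw [hdSum_eq_two_mul_hdKSum, hdKSum_eq_hdKYSum hL]

end Sum

section Final

variable [Fintype V] [DecidableEq V] [Fintype E] [DecidableEq E] {ends : E → Sym2 V}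
  {p q r s d : V}

/-- **CLASS C7, reduced**: under the linked hypothesis the general single-`d` statement follows
from `hdKYSum ≤ 0` — the `Y_rs`-part of the `K`-side hub–dead-end colourings prefers
`p ~_W q`. -/
theorem dSignSum_nonpos_of_hdKYSum_nonpos (hL : Linked ends r s d) (hrd : r ≠ d) (hsd : s ≠ d)
    (h : hdKYSum ends p q r s d ≤ 0) : dSignSum ends p q r s d ≤ 0 := by
  have h1 := dSignSum_le_hdSum (ends := ends) (p := p) (q := q) hrd hsd
  rw [hdSum_eq_two_mul_hdKYSum hL] at h1
  linarith

end Final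

end NoPocket

end Summit.Ventures.PercRepro2
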